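import Summits.QuantumFields.YangMills.Theorems.BalabanUVNodesN08HaarCompatibilityGuardMixture

/-!
# BalabanUVNodes ∕ N08 — PER-FIBRE DENSITY BOUNDS INTEGRATE TO A ONE-STEP TRANSPORT BOUND:
# `Ū_*(dU) ≤ (∫ Π_c A_c(U) dU) · dV` whenever every one-variable fibre law is `≤ A_c(U) · Haar`

WIDTH SEAT `pub-ymgap-dag-n08-w3` g4, `W-SEAT-START-LIST.md` v10 §0 (iii); item-3 lineage part 16 (the measure-theoretic bridge from the ONE-BOND inputs —
part 14 p607823 `…GuardJacobian`, n08-w6's sharp determinant — to the ONE-STEP transport bound asked by n08-w1's (R4⁗) ∕ CLAIM-18 family), 2026-08-28.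
DAG node N08 = [Balaban1985UV3] Thm 1 p. 257 (compact) + Thm 2 p. 272; key item K1⁷ `StabilityBAtRecordR13SepCoPH` (stmt-QuantumFields-20542),
`--supports … --as helper`.  COUNT-NEUTRAL.

THE POINT.  Part 13 (p604469 `…GuardMixture.map_avgFun_eq_map_resample`) put the image law of the typed (0.4) averaging in MIXTURE NORMAL FORM:
`Ū_*(dU) = (dU ⊗ Haar^{PBond(j+1)}) ∘ R⁻¹`, `R(U, g) = (c ↦ Ū(c)(U[β(c) ↦ g_c]))` — background by background the coarse bonds are INDEPENDENT images of
Haar variables under the one-variable fibre maps `g ↦ Ū(c)(U[β(c) ↦ g])`.  This file proves the general measure-theoretic bridge that turns ANY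
background-dependent domination of the one-variable fibre laws into a domination of the mixture:
* §1 `pi_le_prod_smul_pi` — FACTORWISE DOMINATION INTEGRATES OVER A FINITE PRODUCT: `(∀ i, α i ≤ A i • ν i) ⇒ ⊗ α ≤ (Π A i) • ⊗ ν` (outer-measure
  maximality of `Measure.pi` — `OuterMeasure.le_pi`; no densities, no Radon–Nikodym).
* §2 ★★ `map_prod_pi_le_lintegral_smul` — THE MIXTURE BOUND: for a background law `μ`, fibre maps `F c b : Y → Y` (jointly measurable) with
  `(F c b)_* ν ≤ A c b • ν'` (`A c` measurable, values in `(0, ∞)`): `(μ ⊗ ν^κ)∘(b, g ↦ (c ↦ F c b g_c))⁻¹ ≤ (∫⁻ Π_c A c b dμ) • ν'^κ`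
  (Fubini `Measure.prod_apply` + Mathlib's `pi_map_pi` + §1, set by set).
* §3 ★★★ `map_avgFun_le_lintegral_smul` — AT THE TYPED (0.4) AVERAGING (any group, any measurable small-loop average, standing range): if every fibre
  law obeys `Haar∘(g ↦ Ū(c)(U[β(c) ↦ g]))⁻¹ ≤ A c U • Haar`, then **`Ū_*(dU) ≤ (∫⁻ Π_c A c U dU) • dV`**; with a constant `A ≡ K`:
  `Ū_*(dU) ≤ K^{#PBond(j+1)} • dV` (`map_avgFun_le_pow_smul`, the crude one-step bound).
* §4 the same at the [B10] slot `avOfPrint N S j` on `SU(N)`, every `N`.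

HOW IT IS MEANT TO BE USED (located; the inputs are NOT supplied here).  With `A c U := 1 + (K − 1)·1[U guard-admitting at c]` — `K` the density
constant of the GUARDED branch (Jacobian `≥ (1 − Σcᵢ)^{N²−1}` per n08-w6's sharp form of part 14, `1 − Σcᵢ = L^{1−d}` at the slot, through a quantitative
local-diffeomorphism engine), the fibre law being EXACTLY a Haar translate off the guard (parts 6∕8) — §3 reads `density(Ū_*(dU)) ≤ E_U Π_c (1 + (K−1)·1[ga_c(U)])`;
evaluating that expectation is the BLOCK-PAIR LOCALITY structure (conditionally on intra-block bonds the guard events of distinct coarse bonds are independent,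
each of probability `≤ s`): `≤ (1 + (K−1)s)^{#PBond(j+1)}`, the honest one-step extensive constant `c₁ ≤ (K−1)s` of `HOME/pub-ymgap-dag-n08-w3/N08-EML-JACOBIAN.md`
§3.  Neither `K` nor the locality is typed here; the k-uniform `hmass` needs in addition the no-stacking structure (ibid. §4).

HONEST FRAMING.  [folklore] measure theory (nothing of Bałaban's asserted); no density bound is CLAIMED for print's averaging — the per-fibre domination is a
HYPOTHESIS; E6′ NOT decided; `hmass` NOT supplied; count-neutral; N08 NOT discharged; counts unmoved (typed 28∕28 · discharged 5∕27); one finite 𝕋⁴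
programme at fixed ε — R4 closes the CONDITIONAL rung `BalabanLadder.UV` only; the Yang–Mills mass gap (Clay) is NOT proved; nothing continuum ∕ OS.
0 `sorry`, 0 `def`, standard axioms.
-/

noncomputable section

open MeasureTheory Function
open scoped ENNReal

namespace Summit.QuantumFields.YangMills.BalabanUVNodes.N08HaarCompatibilityGuardMixtureDensity

/-! ## §1 Factorwise domination integrates over a finite product -/

section Pi

variable {ι : Type*} [Fintype ι] {X : ι → Type*} [∀ i, MeasurableSpace (X i)]

/-- **`(∀ i, α i ≤ A i • ν i) ⇒ ⊗ α ≤ (Π A i) • ⊗ ν`** for finite families of σ-finite measures and constants `A i ∈ (0, ∞)` (outer-measure maximality of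
`Measure.pi`: an outer measure below the product premeasure on boxes is below the product outer measure, `OuterMeasure.le_pi`). [folklore] -/
theorem pi_le_prod_smul_pi (α ν : ∀ i, Measure (X i)) [∀ i, SigmaFinite (α i)] [∀ i, SigmaFinite (ν i)] (A : ι → ℝ≥0∞)
    (hA0 : ∀ i, A i ≠ 0) (hAtop : ∀ i, A i ≠ ∞) (h : ∀ i, α i ≤ A i • ν i) :
    Measure.pi α ≤ (∏ i, A i) • Measure.pi ν := by
  have hP0 : (∏ i, A i) ≠ 0 := Finset.prod_ne_zero_iff.2 fun i _ => hA0 i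
  have hPtop : (∏ i, A i) ≠ ∞ := ENNReal.prod_ne_top fun i _ => hAtop i
  -- the rescaled outer measure of `⊗ α` is below the product premeasure on boxes
  have hle : (∏ i, A i)⁻¹ • (Measure.pi α).toOuterMeasure ≤ OuterMeasure.pi fun i => (ν i).toOuterMeasure := by
    rw [OuterMeasure.le_pi]
    intro s _
    show (∏ i, A i)⁻¹ * Measure.pi α (Set.pi Set.univ s) ≤ ∏ i, ν i (s i)
    rw [Measure.pi_pi]
    calc (∏ i, A i)⁻¹ * ∏ i, α i (s i) ≤ (∏ i, A i)⁻¹ * ∏ i, (A i * ν i (s i)) := by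
          gcongr with i _
          have := h i (s i)
          rwa [Measure.smul_apply, smul_eq_mul] at this
      _ = ∏ i, ν i (s i) := by
          rw [Finset.prod_mul_distrib, ← mul_assoc, ENNReal.inv_mul_cancel hP0 hPtop, one_mul]
  refine Measure.le_iff.2 fun S hS => ?_
  have h1 : (∏ i, A i)⁻¹ * Measure.pi α S ≤ Measure.pi ν S := by
    have h2 : (∏ i, A i)⁻¹ * Measure.pi α S ≤ (OuterMeasure.pi fun i => (ν i).toOuterMeasure) S := hle S
    rwa [Measure.pi_def ν, toMeasure_apply _ _ hS]
  rw [Measure.smul_apply, smul_eq_mul]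
  calc Measure.pi α S = (∏ i, A i) * ((∏ i, A i)⁻¹ * Measure.pi α S) := by
        rw [← mul_assoc, ENNReal.mul_inv_cancel hP0 hPtop, one_mul]
    _ ≤ (∏ i, A i) * Measure.pi ν S := by gcongr

end Pi

/-! ## §2 The mixture bound: background-wise independent fibre maps with dominated laws -/

section Mixture

variable {B : Type*} [MeasurableSpace B] {κ : Type*} [Fintype κ] {Y : Type*} [MeasurableSpace Y]

/-- ★★ **THE MIXTURE BOUND.**  Background law `μ`, independent inputs `ν^κ`, fibre maps `F c b : Y → Y` jointly measurable in `(b, y)`, and a measurable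
background-dependent domination `(F c b)_* ν ≤ A c b • ν'` with `A c b ∈ (0, ∞)`: the law of `(b, g) ↦ (c ↦ F c b (g c))` under `μ ⊗ ν^κ` is dominated by
`(∫⁻ Π_c A c b dμ) • ν'^κ`. [folklore] -/
theorem map_prod_pi_le_lintegral_smul (μ : Measure B) [SFinite μ] (ν ν' : Measure Y) [SigmaFinite ν] [IsFiniteMeasure ν] [SigmaFinite ν']
    (F : κ → B → Y → Y) (hF : ∀ c, Measurable fun p : B × Y => F c p.1 p.2) (A : κ → B → ℝ≥0∞) (hAm : ∀ c, Measurable (A c))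
    (hA0 : ∀ c b, A c b ≠ 0) (hAtop : ∀ c b, A c b ≠ ∞) (hdom : ∀ c b, ν.map (F c b) ≤ A c b • ν') :
    (μ.prod (Measure.pi fun _ : κ => ν)).map (fun p : B × (κ → Y) => fun c => F c p.1 (p.2 c)) ≤
      (∫⁻ b, ∏ c, A c b ∂μ) • Measure.pi fun _ : κ => ν' := by
  have hR : Measurable fun p : B × (κ → Y) => fun c => F c p.1 (p.2 c) :=
    measurable_pi_lambda _ fun c => (hF c).comp (measurable_fst.prodMk ((measurable_pi_apply c).comp measurable_snd))
  have hRb : ∀ b : B, Measurable fun g : κ → Y => fun c => F c b (g c) := fun b =>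
    measurable_pi_lambda _ fun c => ((hF c).comp (measurable_const.prodMk measurable_id)).comp (measurable_pi_apply c)
  have hFcb : ∀ c b, Measurable (F c b) := fun c b => (hF c).comp (measurable_const.prodMk measurable_id)
  refine Measure.le_iff.2 fun S hS => ?_
  rw [Measure.map_apply hR hS, Measure.prod_apply (hR hS), Measure.smul_apply, smul_eq_mul, ← lintegral_mul_const _
    (Finset.measurable_prod _ fun c _ => hAm c)]
  refine lintegral_mono fun b => ?_
  -- the `b`-section is the preimage under the product map `g ↦ (c ↦ F c b (g c))`
  have hsec : Prod.mk b ⁻¹' ((fun p : B × (κ → Y) => fun c => F c p.1 (p.2 c)) ⁻¹' S) = (fun g : κ → Y => fun c => F c b (g c)) ⁻¹' S := rfl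
  rw [hsec, ← Measure.map_apply (hRb b) hS, Measure.pi_map_pi fun c => (hFcb c b).aemeasurable]
  have hpi := pi_le_prod_smul_pi (fun c => ν.map (F c b)) (fun _ => ν') (fun c => A c b) (fun c => hA0 c b) (fun c => hAtop c b)
    fun c => hdom c b
  have := hpi S
  rwa [Measure.smul_apply, smul_eq_mul] at this

end Mixture

/-! ## §3 At the typed (0.4) averaging: per-fibre domination ⇒ `Ū_*(dU) ≤ (∫ Π_c A c U dU) • dV` -/

section Typed

open Literature.MathematicalPhysics.QuantumFieldTheory.Balaban1983to89
open Literature.MathematicalPhysics.QuantumFieldTheory.Balaban1983to89.BlockAveraging (avgFun measurable_avgFun)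
open Literature.MathematicalPhysics.QuantumFieldTheory.Balaban1983to89.BlockAveragingHaarAC (centralBond)
open Summit.QuantumFields.YangMills.BalabanUVNodes.N08HaarCompatibilityGuardMixture (map_avgFun_eq_map_resample)

variable {P : Params} {j : ℕ} {G : Type*} [GaugeGroup G] (ℰ : LoopAverage G) [MeasurableSpace G] [RegularGaugeGroup G]

/-- The one-variable fibre map `(U, g) ↦ Ū(c)(U[β(c) ↦ g])` is jointly measurable. [folklore] -/
theorem measurable_fibreMap (hE : ∀ n, Measurable fun W : Fin (n + 1) → G => ℰ.E W) (c : PBond P (j + 1)) :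
    Measurable fun p : GaugeField P j G × G => avgFun ℰ (update p.1 (centralBond c) p.2) c := by
  classical
  exact (measurable_pi_apply c).comp ((measurable_avgFun ℰ hE).comp measurable_update')

variable [HaarData G]

/-- ★★★ **PER-FIBRE DOMINATION INTEGRATES TO A ONE-STEP TRANSPORT BOUND.**  If for every background `U` and coarse bond `c` the law of the fibre map
`g ↦ Ū(c)(U[β(c) ↦ g])` under Haar is `≤ A c U • Haar` (`A c` measurable, values in `(0, ∞)`), then `Ū_*(dU) ≤ (∫⁻ Π_c A c U dU) • dV` — part 13's mixture
normal form + §2 (standing range, any group, any measurable small-loop average). [cite: Balaban1987RG1, (0.4) p.253 (the typed averaging; bookkeeping)] -/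
theorem map_avgFun_le_lintegral_smul (hj : j + 1 ≤ P.m + P.K) (hE : ∀ n, Measurable fun W : Fin (n + 1) → G => ℰ.E W)
    (A : PBond P (j + 1) → GaugeField P j G → ℝ≥0∞) (hAm : ∀ c, Measurable (A c)) (hA0 : ∀ c U, A c U ≠ 0) (hAtop : ∀ c U, A c U ≠ ∞)
    (hdom : ∀ c U, (HaarData.haar : Measure G).map (fun g => avgFun ℰ (update U (centralBond c) g) c) ≤ A c U • (HaarData.haar : Measure G)) :
    (fieldMeasure P j G).map (avgFun ℰ) ≤ (∫⁻ U, ∏ c, A c U ∂(fieldMeasure P j G)) • fieldMeasure P (j + 1) G := by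
  haveI := HaarData.isProb (G := G)
  rw [map_avgFun_eq_map_resample ℰ hj hE]
  exact map_prod_pi_le_lintegral_smul (fieldMeasure P j G) HaarData.haar HaarData.haar
    (fun c U g => avgFun ℰ (update U (centralBond c) g) c) (measurable_fibreMap ℰ hE) A hAm hA0 hAtop hdom

/-- ★★ **THE CRUDE ONE-STEP BOUND**: a UNIFORM per-fibre density constant `K ∈ (0, ∞)` gives `Ū_*(dU) ≤ K^{#PBond(j+1)} • dV`. [cite: Balaban1987RG1, (0.4) p.253 (bookkeeping)] -/
theorem map_avgFun_le_pow_smul (hj : j + 1 ≤ P.m + P.K) (hE : ∀ n, Measurable fun W : Fin (n + 1) → G => ℰ.E W) {K : ℝ≥0∞} (hK0 : K ≠ 0)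
    (hKtop : K ≠ ∞)
    (hdom : ∀ (c : PBond P (j + 1)) (U : GaugeField P j G),
      (HaarData.haar : Measure G).map (fun g => avgFun ℰ (update U (centralBond c) g) c) ≤ K • (HaarData.haar : Measure G)) :
    (fieldMeasure P j G).map (avgFun ℰ) ≤ K ^ Fintype.card (PBond P (j + 1)) • fieldMeasure P (j + 1) G := by
  haveI := HaarData.isProb (G := G)
  have h := map_avgFun_le_lintegral_smul ℰ hj hE (fun _ _ => K) (fun _ => measurable_const) (fun _ _ => hK0) (fun _ _ => hKtop) hdom
  simpa only [Finset.prod_const, Finset.card_univ, lintegral_const, measure_univ, mul_one] using h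

end Typed

/-! ## §4 At the [B10] slot's averaging `avOfPrint N S j` on `SU(N)` -/

section Slot

open Literature.MathematicalPhysics.QuantumFieldTheory.Balaban1983to89
open Literature.MathematicalPhysics.QuantumFieldTheory.Balaban1985CMP102.Setting (Scales)
open Literature.MathematicalPhysics.QuantumFieldTheory.Balaban1983to89.B10RunsOfRecord (avOfPrint)
open Literature.MathematicalPhysics.QuantumFieldTheory.Balaban1983to89.BlockAveraging (avgFun)
open Literature.MathematicalPhysics.QuantumFieldTheory.Balaban1983to89.BlockAveragingHaarAC (centralBond)
open Literature.MathematicalPhysics.QuantumFieldTheory.Balaban1983to89.ExpMeanLog (expMeanLogSU measurable_expMeanLogSU_E)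
open Literature.MathematicalPhysics.QuantumFieldTheory.Balaban1983to89.Node00 (SU)
open Summit.QuantumFields.YangMills.BalabanUVNodes.N08HaarCompatibilityGuard (avOfPrint_avg_of_le)

variable (N : ℕ) [NeZero N] {L : ℕ}

/-- ★★★ **AT THE SLOT**: a background-dependent domination `A c U • Haar` of the one-variable fibre laws of the printed exp-mean-log averaging gives
`(avOfPrint)_*(dU) ≤ (∫⁻ Π_c A c U dU) • dV`, every `N`, standing range. [cite: Balaban1985UV3, (2) p.256; Balaban1987RG1, (0.4) p.253 (bookkeeping)] -/
theorem map_avOfPrint_le_lintegral_smul (S : Scales L) {j : ℕ} (hj : j + 1 ≤ S.P.m + S.P.K)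
    (A : PBond S.P (j + 1) → GaugeField S.P j (SU N) → ℝ≥0∞) (hAm : ∀ c, Measurable (A c)) (hA0 : ∀ c U, A c U ≠ 0) (hAtop : ∀ c U, A c U ≠ ∞)
    (hdom : ∀ c U, (HaarData.haar : Measure (SU N)).map
        (fun g => avgFun (expMeanLogSU : LoopAverage (SU N)) (update U (centralBond c) g) c) ≤ A c U • (HaarData.haar : Measure (SU N))) :
    (fieldMeasure S.P j (SU N)).map (avOfPrint N S j).avg ≤ (∫⁻ U, ∏ c, A c U ∂(fieldMeasure S.P j (SU N))) • fieldMeasure S.P (j + 1) (SU N) := by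
  rw [avOfPrint_avg_of_le N S hj]
  exact map_avgFun_le_lintegral_smul _ hj measurable_expMeanLogSU_E A hAm hA0 hAtop hdom

/-- ★★ **THE CRUDE ONE-STEP BOUND AT THE SLOT**: a uniform per-fibre density constant `K` gives `(avOfPrint)_*(dU) ≤ K^{#PBond(j+1)} • dV`, every `N`.
[cite: Balaban1985UV3, (2) p.256; Balaban1987RG1, (0.4) p.253 (bookkeeping)] -/
theorem map_avOfPrint_le_pow_smul (S : Scales L) {j : ℕ} (hj : j + 1 ≤ S.P.m + S.P.K) {K : ℝ≥0∞} (hK0 : K ≠ 0) (hKtop : K ≠ ∞)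
    (hdom : ∀ (c : PBond S.P (j + 1)) (U : GaugeField S.P j (SU N)), (HaarData.haar : Measure (SU N)).map
        (fun g => avgFun (expMeanLogSU : LoopAverage (SU N)) (update U (centralBond c) g) c) ≤ K • (HaarData.haar : Measure (SU N))) :
    (fieldMeasure S.P j (SU N)).map (avOfPrint N S j).avg ≤ K ^ Fintype.card (PBond S.P (j + 1)) • fieldMeasure S.P (j + 1) (SU N) := by
  rw [avOfPrint_avg_of_le N S hj]
  exact map_avgFun_le_pow_smul _ hj measurable_expMeanLogSU_E hK0 hKtop hdom

end Slot

end Summit.QuantumFields.YangMills.BalabanUVNodes.N08HaarCompatibilityGuardMixtureDensity
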